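import Literature.Probability.Percolation.KSTPeriodicCorridorStep
import Literature.Probability.Percolation.KSTPeriodicWeak
import HarnessLib

/-!
# KST-type RSW for periodic measures: the closing inequality (Lemma 5)

Topic `Literature/Probability/Percolation`. Proof of [KohlerSchindlerTassion2023, Lemma 5 and
Comment 1] in the constant form `ClosingIneq` of `KSTPeriodicStatements.lean`:
`μ(𝓠(n, m)) μ(𝓑(m)) ≤ μ(𝓑(n))` for `m ≤ n`, for every admissible (positively associated) measure
carried by lattice configurations, granted the planar fact `PartsMeetMPath` (a bridge of
`H = R_t(m + m/12, m)` meets every `m`-path).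

* `openConnIn_of_mPathAt_of_bridgeWalk`: a vertex on an open `m`-path is joined inside `H` to a
  vertex of any open bridge walk of `H`.
* `bridge_of_quasi_of_bridge`: pathwise, `𝓠(n, m) ∩ 𝓑(m) ⊆ 𝓑(n)` — the two anchored `m`-paths of
  the quasi-crossing are joined through the bridge, giving a left–right crossing of the big box
  `R_t(n + n/4 + k, n)`, which narrows to one of `R_t(n + n/12, n)` between its side columns.
* `closingIneq_of`: the inequality, by positive association (`mul_le_real_inter`).

## References

* [KohlerSchindlerTassion2023] L. Köhler-Schindler, V. Tassion, *Crossing probabilities for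
  planar percolation*, Duke Math. J. 172 (2023) 809–838, §4.3 (Lemma 5); Comment 1.
-/

namespace Literature.Probability.Percolation

open LatticeModels SimpleGraph _root_.MeasureTheory

noncomputable section

namespace KSTPeriodic

/-- **A bridge meets every `m`-path**, open-connection form: for a lattice configuration and
`0 < m + t`, a vertex `z` on an open `m`-path of `H = R_t(m + b, m)` is joined inside `H` to some
vertex of any walk of `H` from the left part of its boundary to the right part
(`PartsMeetMPath` applied to the walk and to an open `m`-walk through `z`).
[cite: KohlerSchindlerTassion2023, §4.3, proof of Lemma 5] -/
theorem openConnIn_of_mPathAt_of_bridgeWalk (hPM : PartsMeetMPath) {ω : BondConfig (Site 2)}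
    (hω : ω ⊆ (zdGraph 2).edgeSet) {t b m : ℕ} (hmt : 0 < m + t) {z : Site 2} (hz : MPathAt t b m ω z)
    {p q : Site 2} (P : (zdGraph 2).Walk p q) (hPS : ∀ x ∈ P.support, x ∈ mRegion t b m)
    (hp : p ∈ leftPart t b m) (hq : q ∈ rightPart t b m) :
    ∃ x ∈ P.support, ω ∈ openConnIn (mRegion t b m) z x := by
  classical
  obtain ⟨u, v, Q, hu, hv, hQS, hQω, hzQ⟩ := exists_walk_of_mPathAt hω hz
  rw [mem_upperTarget] at hu hv
  obtain ⟨x, hxP, hxQ⟩ := hPM (-((m : ℤ) + b) - t) (m + b) (-(m : ℤ) - t) m (-(b : ℤ) - t) b p q u v P Q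
    (by omega) (by omega) (by omega) (by omega) (fun x hx => hPS x hx) (fun x hx => hQS x hx)
    hp.2 hq.2 hu.2.2 hu.1 hu.2.1 hv.2.2 hv.1 hv.2.1
  refine ⟨x, hxP, ?_⟩
  have h1 : ω ∈ openConnIn (mRegion t b m) u z := mem_openConnIn_of_mem_support Q hQS hQω hzQ
  have h2 : ω ∈ openConnIn (mRegion t b m) u x := mem_openConnIn_of_mem_support Q hQS hQω hxQ
  rw [openConnIn_comm] at h1
  exact PlanarDuality.openConnIn_trans h1 h2

/-- **`𝓠(n, m) ∩ 𝓑(m) ⊆ 𝓑(n)` pathwise** (`m ≤ n`, lattice configuration): the anchors `z₁`, `z₂`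
of the quasi-crossing of `R_t(n + n/4 + k, n)` lie on open `m`-paths, both of which meet the open
bridge walk of `H = R_t(m + m/12, m) ⊆ R_t(n + n/4 + k, n)`; hence the left column of the big box
is joined inside it to the right column, and the crossing narrows to a left–right crossing of
`R_t(n + n/12, n)`, which realises `𝓑(n)`. (For `m = t = 0` the region `H` is a single point
and `z₁ = z₂`.) [cite: KohlerSchindlerTassion2023, Lemma 5] -/
theorem bridge_of_quasi_of_bridge (hPM : PartsMeetMPath) {ω : BondConfig (Site 2)}
    (hω : ω ⊆ (zdGraph 2).edgeSet) {t k n m : ℕ} (hmn : m ≤ n)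
    (hQ : ω ∈ quasi t (n / 4 + k) n (m / 12) m) (hB : ω ∈ bridge t (m / 12) m) :
    ω ∈ bridge t (n / 12) n := by
  classical
  obtain ⟨⟨z₁, hM₁, l, hl, hl0, hc₁⟩, ⟨z₂, hM₂, r, hr, hr0, hc₂⟩⟩ := hQ
  have hmn' : (m : ℤ) ≤ n := by exact_mod_cast hmn
  have hdiv : ((m / 12 : ℕ) : ℤ) ≤ ((n / 4 : ℕ) : ℤ) + k := by
    have : m / 12 ≤ n / 4 + k := by omega
    exact_mod_cast this
  have hHB : mRegion t (m / 12) m ⊆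
      rect (-((n : ℤ) + ((n / 4 + k : ℕ) : ℤ)) - t) (n + ((n / 4 + k : ℕ) : ℤ)) (-(n : ℤ) - t) n := by
    intro x hx
    simp only [mRegion, mem_rect] at hx ⊢
    push_cast at hx hdiv ⊢
    omega
  -- the two anchors are joined inside the big box
  have hz : ω ∈ openConnIn (rect (-((n : ℤ) + ((n / 4 + k : ℕ) : ℤ)) - t) (n + ((n / 4 + k : ℕ) : ℤ))
      (-(n : ℤ) - t) n) z₁ z₂ := by
    obtain ⟨u₁, -, hu₁⟩ := hM₁.1
    obtain ⟨u₂, -, hu₂⟩ := hM₂.1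
    by_cases hmt : m + t = 0
    · -- degenerate case: `H` is a single point
      have hm0 : m = 0 := by omega
      have ht0 : t = 0 := by omega
      subst hm0; subst ht0
      have h1 : z₁ ∈ mRegion 0 (0 / 12) 0 := hu₁.1
      have h2 : z₂ ∈ mRegion 0 (0 / 12) 0 := hu₂.1
      simp only [mRegion, mem_rect] at h1 h2
      push_cast at h1 h2
      have heq : z₁ = z₂ := Site.eq_iff_two.2 ⟨by omega, by omega⟩
      rw [← heq]
      exact openConnIn_refl (hHB hu₁.1)
    · obtain ⟨p, hp, q, hq, hpq⟩ := hB
      obtain ⟨P, hPS, hPω⟩ := exists_walk_of_mem_openConnIn hω hpq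
      obtain ⟨x₁, hx₁P, hx₁⟩ := openConnIn_of_mPathAt_of_bridgeWalk hPM hω (by omega) hM₁ P hPS hp hq
      obtain ⟨x₂, hx₂P, hx₂⟩ := openConnIn_of_mPathAt_of_bridgeWalk hPM hω (by omega) hM₂ P hPS hp hq
      have h1 : ω ∈ openConnIn (mRegion t (m / 12) m) p x₁ := mem_openConnIn_of_mem_support P hPS hPω hx₁P
      have h2 : ω ∈ openConnIn (mRegion t (m / 12) m) p x₂ := mem_openConnIn_of_mem_support P hPS hPω hx₂P
      rw [openConnIn_comm] at h1 hx₂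
      exact openConnIn_mono hHB _ _ (PlanarDuality.openConnIn_trans hx₁
        (PlanarDuality.openConnIn_trans h1 (PlanarDuality.openConnIn_trans h2 hx₂)))
  -- a left–right crossing of the big box
  have hLR : ω ∈ lrRect (-((n : ℤ) + ((n / 4 + k : ℕ) : ℤ)) - t) (n + ((n / 4 + k : ℕ) : ℤ)) (-(n : ℤ) - t) n := by
    refine ⟨l, ⟨hl, hl0⟩, r, ⟨hr, hr0⟩, ?_⟩
    rw [openConnIn_comm] at hc₁
    exact PlanarDuality.openConnIn_trans hc₁ (PlanarDuality.openConnIn_trans hz hc₂)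
  -- narrowed to the bridge box
  have hdiv' : ((n / 12 : ℕ) : ℤ) ≤ ((n / 4 + k : ℕ) : ℤ) := by
    have : n / 12 ≤ n / 4 + k := by omega
    exact_mod_cast this
  have hLR' : ω ∈ lrRect (-((n : ℤ) + ((n / 12 : ℕ) : ℤ)) - t) (n + ((n / 12 : ℕ) : ℤ)) (-(n : ℤ) - t) n :=
    lrRect_subset_lrRect hω (by omega) (by omega) (by omega) le_rfl le_rfl hLR
  obtain ⟨x, ⟨hxR, hx0⟩, y, ⟨hyR, hy0⟩, hxy⟩ := hLR'
  exact ⟨x, ⟨hxR, Or.inl hx0⟩, y, ⟨hyR, Or.inl hy0⟩, hxy⟩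

/-- **Lemma 5 (closing), periodic form** ([KohlerSchindlerTassion2023, Lemma 5 with Comment 1]):
`μ(𝓠(n, m)) · μ(𝓑(m)) ≤ μ(𝓑(n))` for `m ≤ n` and every admissible measure carried by lattice
configurations — positive association for the two increasing events, then
`bridge_of_quasi_of_bridge` almost surely. [cite: KohlerSchindlerTassion2023, Lemma 5 and Comment 1] -/
theorem closingIneq_of (hPM : PartsMeetMPath) (k t : ℕ) : ClosingIneq k t := by
  intro μ _ hμ hL n m hmn _ _
  calc μ.real (quasi t (n / 4 + k) n (m / 12) m) * μ.real (bridge t (m / 12) m)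
      ≤ μ.real (quasi t (n / 4 + k) n (m / 12) m ∩ bridge t (m / 12) m) :=
        mul_le_real_inter hμ (isUpperSet_quasi _ _ _ _ _) (isUpperSet_bridge _ _ _)
          (measurableSet_quasi _ _ _ _ _) (measurableSet_bridge _ _ _)
    _ ≤ μ.real (bridge t (n / 12) n) := by
        refine measureReal_mono_of_ae ?_
        filter_upwards [hL] with ω hω h
        exact bridge_of_quasi_of_bridge hPM hω hmn h.1 h.2

end KSTPeriodic

end

end Literature.Probability.Percolation
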